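import Literature.Probability.LatticeModels.LayeredPlaneRotatorIsingCertificate
import Literature.Probability.LatticeModels.IsingSAWBound
import Literature.Probability.RandomPlanarGeometry.SAWSquareLatticeCensus
import Literature.Probability.RandomPlanarGeometry.SAWPulledLargeForceExpansionZdTenthOrder
import Literature.Probability.RandomPlanarGeometry.SAWCountStepWords
import Literature.Probability.RandomPlanarGeometry.BDGS2012Proofs
import Mathlib.Analysis.Complex.Exponential
import HarnessLib

/-!
# A certificate-free weak-interlayer window for the classical layered XY model below the mean-field scale:
# Fisher's self-avoiding-walk bound × the kernel SAW census of `ℤ²` × Aizenman–Simon × Lieb–Rivasseau decoupling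

Topic `Literature/Probability/LatticeModels`. Theorem-only file (no definition, no named fact, no sorry, no certificate
hypothesis).

For the classical layered XY (plane-rotator) model on a finite `Λ ⊂ ℤ³` with in-plane coupling `J∥`, stacking
coupling `J⊥` and inverse temperature `β` (`PlaneRotator.layeredXYCoupling`, free boundary condition), the tree's
UNCONDITIONAL layer decoupling (`PlaneRotator.twoPoint_layered_le_pow_interlayer'`, Lieb 1980 eq. (23) /
Rivasseau 1980, file `LayeredPlaneRotatorDecoupling.lean`) reads
`⟨cos(θ_a − θ_c)⟩_Λ ≤ (βJ⊥ χ∥)^{|ℓ(a) − ℓ(c)|}` for ANY uniform ceiling `χ∥` on the single-layer susceptibility.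
The tree feeds `χ∥` either from a Duminil-Copin–Tassion box value (`LayeredPlaneRotatorIsingCertificate.lean`) or from
certified Toeplitz determinants (`LayeredPlaneRotatorToeplitzCertificate.lean`) — both EXTERNAL certificates entering as
hypotheses — while the tree's certificate-free explicit windows (`LayeredPlaneRotatorExplicitWindow.lean`, Lieb's
star in Amos' form; clustering in all directions) live at `k_BT ≥ 1.961·J∥`. This file supplies a `χ∥` that is KERNEL
END TO END and reaches below `2J∥`:

1. **Fisher's self-avoiding-walk majorant with the tree's SAW census** (§1–§2). By iterated submultiplicativity
   `c_{mq+r} ≤ c_m^q c_r` (tree `SAW.Zd.count_mul_add_le`, Madras–Slade Lemma 1.2.2) the SAW generating function obeys, for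
   every block length `m ≥ 1` and `0 ≤ t` with `c_m tᵐ < 1`,
   `∑_{n<N} c_n tⁿ ≤ (∑_{r<m} c_r tʳ)/(1 − c_m tᵐ)` for all `N` (`sum_count_mul_pow_le_div`); with the kernel census
   `c₁…c₁₀(ℤ²) = 4, 12, 36, 100, 284, 780, 2172, 5916, 16268, 44100` (tree `SAW.Zd.count_two_le_nine`,
   `SAW.Zd.WordTypes.count_ten_two_three`) this is the explicit rational function
   `F(t) = S₁₀(t)/(1 − 44100 t¹⁰)` (`sum_card_sawWords_two_mul_pow_le`), valid for `t < 44100^{-1/10} = 0.3432…`.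
   Fisher's inequality (tree `sum_twoPointFree_le_of_sawSum_le`, M. E. Fisher, Phys. Rev. 162 (1967) 480) then bounds
   every finite-volume free-boundary susceptibility of the planar Ising model:
   `∑_{v ∈ S} ⟨σ_uσ_v⟩^∅_{S;β'} ≤ F(tanh β')` (`sum_isingTwoPoint_two_free_le_sawSeries`).
2. **One XY layer ≤ planar Ising at `β' = βJ∥/2`** (Aizenman–Simon 1980 eq. (1), tree theorem
   `PlaneRotator.twoPoint_inPlane_le_isingTwoPoint`) ⇒ `χ∥ ≤ F(tanh(βJ∥/2))`
   (`PlaneRotator.sum_twoPoint_inPlane_le_of_isingBound`, `…_le_sawSeries`).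
3. **Assembly** (`PlaneRotator.twoPoint_layered_le_pow_sawSeries`): for `β, J∥ > 0`, `J⊥ ≥ 0`, `tanh(βJ∥/2) ≤ t₀`,
   `44100 t₀¹⁰ < 1`, every finite `Λ ⊂ ℤ³` and all `a, c ∈ Λ`:

     `⟨cos(θ_a − θ_c)⟩_{Λ,β} ≤ (β J⊥ F(t₀))^{|ℓ(a) − ℓ(c)|}`.

4. **Decimal rows** (§4; exact rational arithmetic, `tanh` enclosed through `Real.exp_bound'`):
   * `k_BT = 2J∥` (`βJ∥ = 1/2`): `J⊥ ≤ (9/20)·J∥` ⇒ decay `(0.992)^{|Δℓ|}` (`…_at_half`);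
   * `k_BT = (5/3)J∥` (`βJ∥ = 3/5`): `J⊥ ≤ (19/100)·J∥` ⇒ `(0.965)^{|Δℓ|}` (`…_at_three_fifths`);
   * **`k_BT = (π/2)J∥` (`βJ∥ = 2/π`): `J⊥ ≤ J∥/8` ⇒ `(0.9907)^{|Δℓ|}`** (`…_at_pi_div_two`);
   * `k_BT = J∥/log 2 = 1.4427·J∥` (`βJ∥ = log 2`, `tanh β' = 1/3` exactly): `J⊥ ≤ J∥/32` ⇒ `(0.96)^{|Δℓ|}`
     (`…_at_log_two`).

Reading (cell `pub/hubbard-tc`, MO-S3 ORDER → T_c back-end, ASSUMPTIONS §0/§1 keys K4 / K4-a / K4-c; classical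
comparison model, context only): in the K4-c grammar «no inter-layer order of the layered XY model at `T₀` whenever
`J⊥ χ∥(T₀) < T₀`», the in-plane susceptibility is now a KERNEL number down to `T₀ = 1.398·J∥` with no Monte-Carlo,
no mean-field step and no external certificate; in particular **at `T = (π/2)·J∥` the layered comparison model is not
ordered across the layers for every `J⊥ ≤ J∥/8`**, while for `J⊥ ≥ 0.9·J∥` it IS ordered there (tree
`AnisotropicRotator.layered_plateau_ge_at_pi_div_two`, `PlaneRotatorThreeDimOrderingFloor.lean`): the no-factor
form K4-a («`T_c^{3D} ≤ (π/2)·J∥(0)`») of the cell's 2D→3D interface holds for the comparison model at every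
anisotropy `Δ = J⊥/J∥ ≤ 1/8` and fails at `Δ ≥ 9/10` — kernel brackets on a threshold the cell carries as
`Δ* = 0.27 ± 0.02` [float, Monte Carlo]. HONEST FRAMING: finite-volume statements about the CLASSICAL layered XY model,
uniform in the volume; «not ordered» means geometric decay of the two-point function ACROSS the layers (the K4-c
currency), nothing is claimed about in-plane decay; material use rests on the modelling key K5 exactly as for the
tree's other layered-XY files.

Not here: sharper census (`c₁₁, c₁₂, …` would push the method's reach from `T > 1.398·J∥` toward the
Aizenman–Simon–Fisher limit `tanh(βJ∥/2) < 1/μ(ℤ²)`, i.e. `T ≳ 1.26·J∥`; the Aizenman–Simon–Onsager cap of this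
comparison family is `T > 1.1346·J∥`); in-plane clustering; the lower direction (Ginibre / infrared bounds, see
`PlaneRotatorThreeDimOrderingFloor.lean`).

References: M. E. Fisher, Phys. Rev. 162 (1967) 480 [Fisher1967]; N. Madras, G. Slade, *The Self-Avoiding Walk* (1993),
§1.2 and Appendix C Table C.1 [MadrasSlade1993]; M. Aizenman, B. Simon, Phys. Lett. A 76 (1980) 281
[AizenmanSimon1980RotorIsing]; E. H. Lieb, Commun. Math. Phys. 77 (1980) 127 [Lieb1980]; L. L. Liu, H. E. Stanley,
Phys. Rev. Lett. 29 (1972) 927 (layered `(J, J, εJ)` model) [LiuStanley1972].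

Mathlib/tree anchors: `Finset.sum_range_succ`, `Finset.sum_range_add`, `geom_sum_Ico_le_of_lt_one`, `Real.exp_bound'`, `Real.pi_gt_d6`,
`Real.log_two_lt_d9`, `Real.tanh_eq_sinh_div_cosh`; tree `sum_twoPointFree_le_of_sawSum_le`,
`isingTwoPoint_free_le_twoPointFree_sub`, `isingTwoPoint_free_nonneg'`, `SAW.Zd.card_sawWords_eq_count`,
`SAW.Zd.count_mul_add_le`, `SAW.Zd.count_zero`, `SAW.Zd.count_two_le_nine`, `SAW.Zd.WordTypes.count_ten_two_three`,
`PlaneRotator.twoPoint_inPlane_le_isingTwoPoint`, `PlaneRotator.twoPoint_layered_le_pow_interlayer'`.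
-/

noncomputable section

open Finset Filter
open scoped BigOperators Topology

namespace Literature.Probability.LatticeModels

open Literature.Probability.Percolation (sawWords)
open Literature.Probability.RandomPlanarGeometry.SAW.Zd (count count_mul_add_le count_zero card_sawWords_eq_count)

/-! ### §1. The self-avoiding-walk generating function from a finite census and submultiplicativity -/

section SAWSeries

/-- Block form of the SAW generating function: `∑_{n < mQ} c_n tⁿ ≤ (∑_{r<m} c_r tʳ) · ∑_{q<Q} (c_m tᵐ)^q` (`t ≥ 0`).
[cite: MadrasSlade1993, §1.2 eq. (1.2.3) and Lemma 1.2.2] -/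
theorem sum_count_mul_pow_block_le (d m Q : ℕ) {t : ℝ} (ht : 0 ≤ t) :
    ∑ n ∈ range (m * Q), (count d n : ℝ) * t ^ n ≤
      (∑ r ∈ range m, (count d r : ℝ) * t ^ r) * ∑ q ∈ range Q, ((count d m : ℝ) * t ^ m) ^ q := by
  induction Q with
  | zero => simp
  | succ Q ih =>
      rw [Nat.mul_succ, Finset.sum_range_add, Finset.sum_range_succ, mul_add]
      refine add_le_add ih ?_
      rw [Finset.sum_mul]
      refine Finset.sum_le_sum fun r _ => ?_
      have hc : (count d (m * Q + r) : ℝ) ≤ (count d m : ℝ) ^ Q * count d r := by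
        exact_mod_cast count_mul_add_le d m Q r
      calc (count d (m * Q + r) : ℝ) * t ^ (m * Q + r)
          ≤ ((count d m : ℝ) ^ Q * count d r) * t ^ (m * Q + r) :=
            mul_le_mul_of_nonneg_right hc (pow_nonneg ht _)
        _ = (count d r : ℝ) * t ^ r * ((count d m : ℝ) * t ^ m) ^ Q := by
            rw [pow_add, pow_mul, mul_pow]; ring

/-- **SAW generating function from a finite census**: if `c_m tᵐ < 1` (`m ≥ 1`, `t ≥ 0`) then for every `N`
`∑_{n<N} c_n tⁿ ≤ (∑_{r<m} c_r tʳ)/(1 − c_m tᵐ)` — the series converges geometrically in blocks of length `m` by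
`c_{mq+r} ≤ c_m^q c_r`. [cite: MadrasSlade1993, §1.2 eq. (1.2.3) and Lemma 1.2.2] -/
theorem sum_count_mul_pow_le_div (d : ℕ) {m : ℕ} (hm : 1 ≤ m) {t : ℝ} (ht : 0 ≤ t)
    (hρ : (count d m : ℝ) * t ^ m < 1) (N : ℕ) :
    ∑ n ∈ range N, (count d n : ℝ) * t ^ n ≤
      (∑ r ∈ range m, (count d r : ℝ) * t ^ r) / (1 - (count d m : ℝ) * t ^ m) := by
  set ρ : ℝ := (count d m : ℝ) * t ^ m with hρdef
  have hρ0 : 0 ≤ ρ := mul_nonneg (Nat.cast_nonneg _) (pow_nonneg ht _)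
  have hS0 : 0 ≤ ∑ r ∈ range m, (count d r : ℝ) * t ^ r :=
    Finset.sum_nonneg fun r _ => mul_nonneg (Nat.cast_nonneg _) (pow_nonneg ht _)
  have hterm : ∀ n, 0 ≤ (count d n : ℝ) * t ^ n := fun n => mul_nonneg (Nat.cast_nonneg _) (pow_nonneg ht _)
  have hNle : N ≤ m * N := Nat.le_mul_of_pos_left N hm
  calc ∑ n ∈ range N, (count d n : ℝ) * t ^ n
      ≤ ∑ n ∈ range (m * N), (count d n : ℝ) * t ^ n :=
        Finset.sum_le_sum_of_subset_of_nonneg (Finset.range_mono hNle) fun n _ _ => hterm n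
    _ ≤ (∑ r ∈ range m, (count d r : ℝ) * t ^ r) * ∑ q ∈ range N, ρ ^ q :=
        sum_count_mul_pow_block_le d m N ht
    _ ≤ (∑ r ∈ range m, (count d r : ℝ) * t ^ r) * (1 - ρ)⁻¹ := by
        refine mul_le_mul_of_nonneg_left ?_ hS0
        have h := geom_sum_Ico_le_of_lt_one (m := 0) (n := N) hρ0 hρ
        rw [pow_zero, one_div, ← Finset.range_eq_Ico] at h
        exact h
    _ = _ := by rw [div_eq_mul_inv]

/-- The census polynomial `S₁₀(t) = ∑_{n<10} c_n(ℤ²) tⁿ` with the tree's kernel values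
`c₀…c₉ = 1, 4, 12, 36, 100, 284, 780, 2172, 5916, 16268`. [cite: MadrasSlade1993, Appendix C Table C.1 (d = 2)] -/
theorem sum_range_ten_count_two_mul_pow (t : ℝ) :
    ∑ r ∈ range 10, (count 2 r : ℝ) * t ^ r =
      1 + 4 * t + 12 * t ^ 2 + 36 * t ^ 3 + 100 * t ^ 4 + 284 * t ^ 5 + 780 * t ^ 6 + 2172 * t ^ 7 +
        5916 * t ^ 8 + 16268 * t ^ 9 := by
  obtain ⟨h1, h2, h3, h4, h5, h6, h7, h8, h9⟩ :=
    Literature.Probability.RandomPlanarGeometry.SAW.Zd.count_two_le_nine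
  simp only [Finset.sum_range_succ, Finset.sum_range_zero, count_zero, h1, h2, h3, h4, h5, h6, h7, h8, h9]
  push_cast
  ring

/-- **The planar SAW generating function, kernel-explicit**: for `0 ≤ t` with `44100·t¹⁰ < 1` and every `N`,
`∑_{n<N} σ(n) tⁿ ≤ S₁₀(t)/(1 − 44100 t¹⁰)` with `σ(n) = #sawWords 2 n = c_n(ℤ²)` (tree bijection
`card_sawWords_eq_count`) and `c₁₀(ℤ²) = 44100` (tree `count_ten_two_three`).
[cite: MadrasSlade1993, Appendix C Table C.1 (d = 2) and Lemma 1.2.2] -/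
theorem sum_card_sawWords_two_mul_pow_le {t : ℝ} (ht : 0 ≤ t) (hρ : 44100 * t ^ 10 < 1) (N : ℕ) :
    ∑ n ∈ range N, ((sawWords 2 n).card : ℝ) * t ^ n ≤
      (1 + 4 * t + 12 * t ^ 2 + 36 * t ^ 3 + 100 * t ^ 4 + 284 * t ^ 5 + 780 * t ^ 6 + 2172 * t ^ 7 +
        5916 * t ^ 8 + 16268 * t ^ 9) / (1 - 44100 * t ^ 10) := by
  have h10 : count 2 10 = 44100 :=
    Literature.Probability.RandomPlanarGeometry.SAW.Zd.WordTypes.count_ten_two_three.1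
  have hρ' : (count 2 10 : ℝ) * t ^ 10 < 1 := by rw [h10]; exact_mod_cast hρ
  have h := sum_count_mul_pow_le_div 2 (m := 10) (by norm_num) ht hρ' N
  simp only [card_sawWords_eq_count]
  rw [sum_range_ten_count_two_mul_pow, h10] at h
  push_cast at h
  exact h

end SAWSeries

/-! ### §2. Fisher's bound at an arbitrary base point; the planar Ising susceptibility below `β' = 0.3577` -/

section Fisher

variable {d : ℕ}

/-- **Fisher's summed bound at any base point of any finite volume**: if `∑_{n<N} σ(n) tanh(β)ⁿ ≤ K` for all `N`,
then `∑_{v ∈ Λ} ⟨σ_uσ_v⟩^∅_{Λ;β} ≤ K` for every finite `Λ ⊂ ℤ^d` and `u ∈ Λ` (`β ≥ 0`): volume monotonicity and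
translation covariance of the free state (tree `isingTwoPoint_free_le_twoPointFree_sub`) reduce to the tree's
infinite-volume form `sum_twoPointFree_le_of_sawSum_le`.
[cite: Fisher1967, Phys. Rev. 162 (1967) 480 (T_c bounds from self-avoiding walks)] -/
theorem sum_isingTwoPoint_free_le_of_sawSum_le_of_mem {β : ℝ} (hβ : 0 ≤ β) {K : ℝ}
    (hK : ∀ N : ℕ, ∑ n ∈ range N, ((sawWords d n).card : ℝ) * Real.tanh β ^ n ≤ K)
    (Λ : Finset (Site d)) {u : Site d} (hu : u ∈ Λ) :
    ∑ v ∈ Λ, isingTwoPoint (zdGraph d) Λ β 0 .free u v ≤ K := by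
  have hgks2 : ∀ (G' : SimpleGraph (Site d)) [G'.LocallyFinite] (Λ A B : Finset (Site d))
      (β h : ℝ) (bc : BoundaryCondition (Site d)),
      gks_two G' (Λ := Λ) (A := A) (B := B) (β := β) (h := h) (bc := bc) :=
    fun G' _ _ _ _ _ _ _ => GKSInequalities.gks_two_holds G'
  have hlim : hasBoxLimit_isingCorr_free d := hasBoxLimit_isingCorr_free_holds
  have hmono : isingCorr_free_mono_volume (d := d) := isingCorr_free_mono_volume_of_gks_two hgks2
  have htr : isingTwoPoint_free_translate (d := d) := isingTwoPoint_free_translate_holds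
  calc ∑ v ∈ Λ, isingTwoPoint (zdGraph d) Λ β 0 .free u v
      ≤ ∑ v ∈ Λ, twoPointFree d β (v - u) :=
        Finset.sum_le_sum fun v hv => isingTwoPoint_free_le_twoPointFree_sub hmono hlim htr hβ hu hv
    _ = ∑ w ∈ Λ.image (· - u), twoPointFree d β w := by
        rw [Finset.sum_image fun x _ y _ h => sub_left_injective h]
    _ ≤ K := sum_twoPointFree_le_of_sawSum_le hβ hK _

/-- **The planar Ising susceptibility in finite volume, kernel-explicit** (Fisher × census): for `0 ≤ β'` with
`tanh β' ≤ t₀` and `44100 t₀¹⁰ < 1`, every finite `Λ ⊂ ℤ²` and `u ∈ Λ`: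
`∑_{v ∈ Λ} ⟨σ_uσ_v⟩^∅_{Λ;β'} ≤ S₁₀(t₀)/(1 − 44100 t₀¹⁰)`. At `β' = 1/π` (`t₀ = 0.308`): `≤ 12.449`.
[cite: Fisher1967, Phys. Rev. 162 (1967) 480 (T_c bounds from self-avoiding walks)]
[cite: MadrasSlade1993, Appendix C Table C.1 (d = 2)] -/
theorem sum_isingTwoPoint_two_free_le_sawSeries {β : ℝ} (hβ : 0 ≤ β) {t₀ : ℝ} (ht : Real.tanh β ≤ t₀)
    (hρ : 44100 * t₀ ^ 10 < 1) (Λ : Finset (Site 2)) {u : Site 2} (hu : u ∈ Λ) :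
    ∑ v ∈ Λ, isingTwoPoint (zdGraph 2) Λ β 0 .free u v ≤
      (1 + 4 * t₀ + 12 * t₀ ^ 2 + 36 * t₀ ^ 3 + 100 * t₀ ^ 4 + 284 * t₀ ^ 5 + 780 * t₀ ^ 6 + 2172 * t₀ ^ 7 +
        5916 * t₀ ^ 8 + 16268 * t₀ ^ 9) / (1 - 44100 * t₀ ^ 10) := by
  have ht0 : 0 ≤ Real.tanh β := tanh_nonneg hβ
  have ht00 : 0 ≤ t₀ := ht0.trans ht
  refine sum_isingTwoPoint_free_le_of_sawSum_le_of_mem hβ (fun N => ?_) Λ hu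
  calc ∑ n ∈ range N, ((sawWords 2 n).card : ℝ) * Real.tanh β ^ n
      ≤ ∑ n ∈ range N, ((sawWords 2 n).card : ℝ) * t₀ ^ n :=
        Finset.sum_le_sum fun n _ =>
          mul_le_mul_of_nonneg_left (pow_le_pow_left₀ ht0 ht n) (Nat.cast_nonneg _)
    _ ≤ _ := sum_card_sawWords_two_mul_pow_le ht00 hρ N

end Fisher

/-! ### §3. The layered XY model: in-plane susceptibility from any planar Ising bound; the decoupled window -/

namespace PlaneRotator

section LayeredFisher

open Literature.Barriers.CriticalPhenomena Literature.Barriers.CriticalPhenomena.LongRangeIsing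

variable {Λ : Finset (Site 3)} {β Jp Jz : ℝ}
variable [MeasurableSpace Circle] [BorelSpace Circle]

omit [MeasurableSpace Circle] [BorelSpace Circle] in
/-- Projection to `ℤ²` is injective on one layer of `Λ`. [folklore] -/
private theorem init_injOn_layer (k : ℤ) :
    Set.InjOn (fun x : Λ => Fin.init (x : Site 3)) ↑(univ.filter (fun x : Λ => layer x = k)) := by
  intro x hx y hy hxy
  simp only [Finset.coe_filter, Finset.mem_univ, true_and, Set.mem_setOf_eq] at hx hy
  apply Subtype.ext
  have hx3 : (x : Site 3) = Fin.snoc (Fin.init (x : Site 3)) ((x : Site 3) (Fin.last 2)) :=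
    (Fin.snoc_init_self _).symm
  have hy3 : (y : Site 3) = Fin.snoc (Fin.init (y : Site 3)) ((y : Site 3) (Fin.last 2)) :=
    (Fin.snoc_init_self _).symm
  have hxl : (x : Site 3) (Fin.last 2) = k := hx
  have hyl : (y : Site 3) (Fin.last 2) = k := hy
  rw [hx3, hy3, hxl, hyl]
  exact congrArg (fun z => (Fin.snoc z k : Site 3)) hxy

omit [MeasurableSpace Circle] [BorelSpace Circle] in
/-- The projected layer lies in `layerSites Λ k`. [folklore] -/
private theorem image_init_layer_subset (k : ℤ) :
    (univ.filter (fun x : Λ => layer x = k)).image (fun x : Λ => Fin.init (x : Site 3)) ⊆ layerSites Λ k := by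
  intro z hz
  obtain ⟨x, hx, rfl⟩ := Finset.mem_image.1 hz
  simp only [Finset.mem_filter, Finset.mem_univ, true_and] at hx
  exact Finset.mem_image.2 ⟨x, Finset.mem_filter.2 ⟨x.2, hx⟩, rfl⟩

omit [MeasurableSpace Circle] [BorelSpace Circle] in
/-- A layer-`k` site projects into `layerSites Λ k`. [folklore] -/
private theorem init_mem_layerSites' {k : ℤ} {x : Λ} (hx : layer x = k) : Fin.init (x : Site 3) ∈ layerSites Λ k :=
  Finset.mem_image.2 ⟨x, Finset.mem_filter.2 ⟨x.2, hx⟩, rfl⟩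

/-- **In-plane susceptibility of the layered XY model from ANY planar Ising bound** (Aizenman–Simon on the layer,
tree `twoPoint_inPlane_le_isingTwoPoint`, then re-indexing by the projection of the layer to `ℤ²`): if every
finite-volume free planar Ising susceptibility at `β' = βJ∥/2` is `≤ χ`, then for every `a ∈ Λ`
`∑_{x ∈ Λ_{ℓ(a)}} ⟨cos(θ_a − θ_x)⟩^{2D}_{Λ_{ℓ(a)}} ≤ χ` — hypothesis `hχ` of `twoPoint_layered_le_pow_interlayer'`.
[cite: AizenmanSimon1980RotorIsing, eq. (1)] -/
theorem sum_twoPoint_inPlane_le_of_isingBound (hβ : 0 ≤ β) (hp : 0 ≤ Jp) (hz : 0 ≤ Jz) (Λ : Finset (Site 3))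
    {χ : ℝ}
    (hIs : ∀ (S : Finset (Site 2)) (u : Site 2), u ∈ S →
      ∑ v ∈ S, isingTwoPoint (zdGraph 2) S (β * Jp / 2) 0 .free u v ≤ χ)
    (a : Λ) :
    ∑ x ∈ univ.filter (fun x : Λ => layer x = layer a),
        twoPoint (inPlane (layeredXYCoupling β Jp Jz Λ) (layer a)) a x ≤ χ := by
  classical
  set k := layer a with hk
  have hβ' : 0 ≤ β * Jp / 2 := by positivity
  set f : Site 2 → ℝ := fun v =>
    isingTwoPoint (zdGraph 2) (layerSites Λ k) (β * Jp / 2) 0 .free (Fin.init (a : Site 3)) v with hf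
  have hf0 : ∀ v ∈ layerSites Λ k, 0 ≤ f v := fun v hv =>
    isingTwoPoint_free_nonneg' hβ' (init_mem_layerSites' rfl) hv
  calc ∑ x ∈ univ.filter (fun x : Λ => layer x = k), twoPoint (inPlane (layeredXYCoupling β Jp Jz Λ) k) a x
      ≤ ∑ x ∈ univ.filter (fun x : Λ => layer x = k), f (Fin.init (x : Site 3)) := by
        refine Finset.sum_le_sum fun x hx => ?_
        simp only [Finset.mem_filter, Finset.mem_univ, true_and] at hx
        exact twoPoint_inPlane_le_isingTwoPoint hβ hp hz Λ a x rfl hx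
    _ = ∑ v ∈ (univ.filter (fun x : Λ => layer x = k)).image (fun x : Λ => Fin.init (x : Site 3)), f v :=
        (Finset.sum_image (init_injOn_layer k)).symm
    _ ≤ ∑ v ∈ layerSites Λ k, f v :=
        Finset.sum_le_sum_of_subset_of_nonneg (image_init_layer_subset k) fun v hv _ => hf0 v hv
    _ ≤ χ := hIs (layerSites Λ k) _ (init_mem_layerSites' rfl)

/-- **In-plane susceptibility of the layered XY model, kernel-explicit** (Aizenman–Simon × Fisher × census): for
`β, J∥ > 0`, `J⊥ ≥ 0`, `tanh(βJ∥/2) ≤ t₀`, `44100 t₀¹⁰ < 1`, every finite `Λ ⊂ ℤ³` and `a ∈ Λ`: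
`∑_{x ∈ Λ_{ℓ(a)}} ⟨cos(θ_a − θ_x)⟩^{2D} ≤ S₁₀(t₀)/(1 − 44100 t₀¹⁰)`.
[cite: AizenmanSimon1980RotorIsing, eq. (1)] [cite: Fisher1967, Phys. Rev. 162 (1967) 480 (T_c bounds from self-avoiding walks)] -/
theorem sum_twoPoint_inPlane_le_sawSeries (hβ : 0 < β) (hp : 0 < Jp) (hz : 0 ≤ Jz) (Λ : Finset (Site 3))
    {t₀ : ℝ} (ht : Real.tanh (β * Jp / 2) ≤ t₀) (hρ : 44100 * t₀ ^ 10 < 1) (a : Λ) :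
    ∑ x ∈ univ.filter (fun x : Λ => layer x = layer a),
        twoPoint (inPlane (layeredXYCoupling β Jp Jz Λ) (layer a)) a x ≤
      (1 + 4 * t₀ + 12 * t₀ ^ 2 + 36 * t₀ ^ 3 + 100 * t₀ ^ 4 + 284 * t₀ ^ 5 + 780 * t₀ ^ 6 + 2172 * t₀ ^ 7 +
        5916 * t₀ ^ 8 + 16268 * t₀ ^ 9) / (1 - 44100 * t₀ ^ 10) :=
  sum_twoPoint_inPlane_le_of_isingBound hβ.le hp.le hz Λ
    (fun S _ hu => sum_isingTwoPoint_two_free_le_sawSeries (by positivity) ht hρ S hu) a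

/-- **Certificate-free layer decoupling of the classical layered XY model** (Lieb–Rivasseau decoupling
`twoPoint_layered_le_pow_interlayer'` × Aizenman–Simon × Fisher's SAW bound with the kernel census of `ℤ²`): for
`β, J∥ > 0`, `J⊥ ≥ 0`, `tanh(βJ∥/2) ≤ t₀`, `44100 t₀¹⁰ < 1`, every finite `Λ ⊂ ℤ³` and all `a, c ∈ Λ`,

  `⟨cos(θ_a − θ_c)⟩_{Λ,β} ≤ (β J⊥ · S₁₀(t₀)/(1 − 44100 t₀¹⁰))^{|ℓ(a) − ℓ(c)|}`.

Every ingredient is a theorem of the tree; no external number enters. Reading (cell `pub/hubbard-tc`, key K4-c):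
whenever `βJ⊥ S₁₀(t₀) < 1 − 44100 t₀¹⁰` the layered model has geometric decay ACROSS the layers uniformly in the
volume — no three-dimensional order at `k_BT = 1/β`; the method reaches every `βJ∥ < 0.7154` (`T > 1.398·J∥`).
[cite: Lieb1980, eq. (23) and notes added in proof (2)] [cite: AizenmanSimon1980RotorIsing, eq. (1)]
[cite: Fisher1967, Phys. Rev. 162 (1967) 480 (T_c bounds from self-avoiding walks)] -/
theorem twoPoint_layered_le_pow_sawSeries (hβ : 0 < β) (hp : 0 < Jp) (hz : 0 ≤ Jz) (Λ : Finset (Site 3))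
    {t₀ : ℝ} (ht : Real.tanh (β * Jp / 2) ≤ t₀) (hρ : 44100 * t₀ ^ 10 < 1) (a c : Λ) :
    twoPoint (layeredXYCoupling β Jp Jz Λ) a c ≤
      (β * Jz * ((1 + 4 * t₀ + 12 * t₀ ^ 2 + 36 * t₀ ^ 3 + 100 * t₀ ^ 4 + 284 * t₀ ^ 5 + 780 * t₀ ^ 6 +
        2172 * t₀ ^ 7 + 5916 * t₀ ^ 8 + 16268 * t₀ ^ 9) / (1 - 44100 * t₀ ^ 10))) ^ (layer a - layer c).natAbs :=
  twoPoint_layered_le_pow_interlayer' hβ.le hp.le hz Λ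
    (fun a => sum_twoPoint_inPlane_le_sawSeries hβ hp hz Λ ht hρ a) a c

/-- Monotone consumption form: if `β J⊥ · S₁₀(t₀)/(1 − 44100 t₀¹⁰) ≤ r` then `⟨cos(θ_a − θ_c)⟩_{Λ,β} ≤ r^{|ℓ(a) − ℓ(c)|}`.
[cite: Lieb1980, eq. (23) and notes added in proof (2)] -/
theorem twoPoint_layered_le_pow_of_sawSeries_le (hβ : 0 < β) (hp : 0 < Jp) (hz : 0 ≤ Jz) (Λ : Finset (Site 3))
    {t₀ : ℝ} (ht : Real.tanh (β * Jp / 2) ≤ t₀) (hρ : 44100 * t₀ ^ 10 < 1) {r : ℝ}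
    (hr : β * Jz * ((1 + 4 * t₀ + 12 * t₀ ^ 2 + 36 * t₀ ^ 3 + 100 * t₀ ^ 4 + 284 * t₀ ^ 5 + 780 * t₀ ^ 6 +
        2172 * t₀ ^ 7 + 5916 * t₀ ^ 8 + 16268 * t₀ ^ 9) / (1 - 44100 * t₀ ^ 10)) ≤ r)
    (a c : Λ) :
    twoPoint (layeredXYCoupling β Jp Jz Λ) a c ≤ r ^ (layer a - layer c).natAbs := by
  have ht0 : 0 ≤ t₀ := (tanh_nonneg (by positivity : 0 ≤ β * Jp / 2)).trans ht
  refine (twoPoint_layered_le_pow_sawSeries hβ hp hz Λ ht hρ a c).trans (pow_le_pow_left₀ ?_ hr _)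
  exact mul_nonneg (mul_nonneg hβ.le hz) (div_nonneg (by positivity) (sub_pos.2 hρ).le)

end LayeredFisher

/-! ### §4. Decimal rows: `k_BT/J∥ = 2, 5/3, π/2, 1/log 2` -/

section Decimals

/-- `tanh y ≤ c` from an upper bound on `exp(2y)`: `c < 1`, `exp(2y) ≤ (1+c)/(1−c)` ⇒ `tanh y ≤ c`. [folklore] -/
private theorem tanh_le_of_exp_two_mul_le {y c : ℝ} (hc : c < 1) (h : Real.exp (2 * y) ≤ (1 + c) / (1 - c)) :
    Real.tanh y ≤ c := by
  rw [Real.tanh_eq_sinh_div_cosh, div_le_iff₀ (Real.cosh_pos y), Real.sinh_eq, Real.cosh_eq]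
  have hc1 : 0 < 1 - c := sub_pos.2 hc
  have hexp : Real.exp y * Real.exp y ≤ (1 + c) / (1 - c) := by
    rw [← Real.exp_add, ← two_mul]; exact h
  have hmul : Real.exp y * Real.exp y * (1 - c) ≤ 1 + c := by
    rwa [le_div_iff₀ hc1] at hexp
  have hneg : Real.exp (-y) * Real.exp y = 1 := by rw [← Real.exp_add, neg_add_cancel, Real.exp_zero]
  have hey : 0 < Real.exp (-y) := Real.exp_pos _
  -- multiply the target inequality by `exp(-y) > 0`
  have key : (Real.exp y - Real.exp (-y)) ≤ c * (Real.exp y + Real.exp (-y)) := by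
    have h1 : Real.exp y * (1 - c) ≤ (1 + c) * Real.exp (-y) := by
      have := mul_le_mul_of_nonneg_right hmul hey.le
      calc Real.exp y * (1 - c) = Real.exp y * Real.exp y * (1 - c) * Real.exp (-y) := by
            rw [mul_comm (Real.exp (-y)) (Real.exp y)] at hneg
            calc Real.exp y * (1 - c) = Real.exp y * (1 - c) * (Real.exp y * Real.exp (-y)) := by
                  rw [hneg, mul_one]
              _ = Real.exp y * Real.exp y * (1 - c) * Real.exp (-y) := by ring
        _ ≤ (1 + c) * Real.exp (-y) := this
    nlinarith [h1]
  linarith [key]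

/-- `tanh(1/4) ≤ 0.245` (`exp(1/2) ≤ 1.64872… ≤ 1.649`). [folklore] -/
private theorem tanh_quarter_le : Real.tanh (1 / 4 : ℝ) ≤ 245 / 1000 := by
  refine tanh_le_of_exp_two_mul_le (by norm_num) ?_
  have h := Real.exp_bound' (x := (2 * (1 / 4) : ℝ)) (by norm_num) (by norm_num) (n := 8) (by norm_num)
  refine h.trans ?_
  simp only [Finset.sum_range_succ, Finset.sum_range_zero, Nat.factorial]
  norm_num

/-- `tanh(3/10) ≤ 0.2914` (`exp(3/5) ≤ 1.82212…`). [folklore] -/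
private theorem tanh_three_tenths_le : Real.tanh (3 / 10 : ℝ) ≤ 2914 / 10000 := by
  refine tanh_le_of_exp_two_mul_le (by norm_num) ?_
  have h := Real.exp_bound' (x := (2 * (3 / 10) : ℝ)) (by norm_num) (by norm_num) (n := 8) (by norm_num)
  refine h.trans ?_
  simp only [Finset.sum_range_succ, Finset.sum_range_zero, Nat.factorial]
  norm_num

/-- `tanh(1/π) ≤ 0.308` (`1/π ≤ 0.31832` by `π > 3.141592`, `exp(0.63664) ≤ 1.890120 ≤ 1.308/0.692`). [folklore] -/
private theorem tanh_inv_pi_le : Real.tanh (1 / Real.pi : ℝ) ≤ 308 / 1000 := by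
  have hpi : (1 / Real.pi : ℝ) ≤ 31832 / 100000 := by
    rw [div_le_iff₀ Real.pi_pos]
    have := Real.pi_gt_d6
    nlinarith
  refine (tanh_le_tanh hpi).trans ?_
  refine tanh_le_of_exp_two_mul_le (by norm_num) ?_
  have h := Real.exp_bound' (x := (2 * (31832 / 100000) : ℝ)) (by norm_num) (by norm_num) (n := 8) (by norm_num)
  refine h.trans ?_
  simp only [Finset.sum_range_succ, Finset.sum_range_zero, Nat.factorial]
  norm_num

/-- `tanh(log 2 / 2) ≤ 1/3` (indeed `= 1/3`: `exp(log 2) = 2`). [folklore] -/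
private theorem tanh_half_log_two_le : Real.tanh (Real.log 2 / 2 : ℝ) ≤ 1 / 3 := by
  refine tanh_le_of_exp_two_mul_le (by norm_num) ?_
  rw [show (2 : ℝ) * (Real.log 2 / 2) = Real.log 2 by ring, Real.exp_log (by norm_num : (0 : ℝ) < 2)]
  norm_num

variable {Λ : Finset (Site 3)} {β Jp Jz : ℝ}
variable [MeasurableSpace Circle] [BorelSpace Circle]

/-- **Row `k_BT = 2J∥`** (`βJ∥ = 1/2`, `tanh(1/4) ≤ 0.245`, `F(0.245) ≤ 4.405`): for `J⊥ ≤ (9/20)·J∥` the interlayer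
two-point function of the classical layered XY model decays like `(0.992)^{|Δℓ|}` on every finite `Λ ⊂ ℤ³` — no
three-dimensional order at `k_BT = 2J∥` for anisotropies `J⊥/J∥ ≤ 0.45`, certificate-free (the tree's Lieb-star
window at the same temperature, `layered_disorder_of_two_le` in `LayeredPlaneRotatorExplicitWindow.lean`, asks
`J⊥ ≤ 0.0596·J∥` — different currency: that file concludes clustering in ALL directions, this one across the layers).
[cite: Lieb1980, eq. (23) and notes added in proof (2)]
[cite: Fisher1967, Phys. Rev. 162 (1967) 480 (T_c bounds from self-avoiding walks)] -/
theorem twoPoint_layered_le_pow_at_half (hβ : 0 < β) (hp : 0 < Jp) (hK : β * Jp = 1 / 2) (hz0 : 0 ≤ Jz)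
    (hz : Jz ≤ 9 / 20 * Jp) (Λ : Finset (Site 3)) (a c : Λ) :
    twoPoint (layeredXYCoupling β Jp Jz Λ) a c ≤ (992 / 1000 : ℝ) ^ (layer a - layer c).natAbs := by
  have ht : Real.tanh (β * Jp / 2) ≤ 245 / 1000 := by
    rw [hK, show ((1 : ℝ) / 2) / 2 = 1 / 4 by norm_num]; exact tanh_quarter_le
  refine twoPoint_layered_le_pow_of_sawSeries_le hβ hp hz0 Λ ht (by norm_num) ?_ a c
  have hβJz : β * Jz ≤ 9 / 40 := by
    have := mul_le_mul_of_nonneg_left hz hβ.le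
    calc β * Jz ≤ β * (9 / 20 * Jp) := this
      _ = 9 / 20 * (β * Jp) := by ring
      _ = 9 / 40 := by rw [hK]; norm_num
  have hF : (0 : ℝ) ≤ (1 + 4 * (245 / 1000 : ℝ) + 12 * (245 / 1000) ^ 2 + 36 * (245 / 1000) ^ 3 +
      100 * (245 / 1000) ^ 4 + 284 * (245 / 1000) ^ 5 + 780 * (245 / 1000) ^ 6 + 2172 * (245 / 1000) ^ 7 +
      5916 * (245 / 1000) ^ 8 + 16268 * (245 / 1000) ^ 9) / (1 - 44100 * (245 / 1000) ^ 10) := by norm_num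
  calc β * Jz * _ ≤ 9 / 40 * _ := mul_le_mul_of_nonneg_right hβJz hF
    _ ≤ 992 / 1000 := by norm_num

/-- **Row `k_BT = (5/3)J∥`** (`βJ∥ = 3/5`, `tanh(3/10) ≤ 0.2914`, `F(0.2914) ≤ 8.46`): for `J⊥ ≤ (19/100)·J∥` the
interlayer two-point function decays like `(0.965)^{|Δℓ|}` on every finite `Λ ⊂ ℤ³` — no three-dimensional order at
`k_BT = (5/3)·J∥` for `J⊥/J∥ ≤ 0.19`, certificate-free, below the mean-field scale `2J∥`.
[cite: Lieb1980, eq. (23) and notes added in proof (2)]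
[cite: Fisher1967, Phys. Rev. 162 (1967) 480 (T_c bounds from self-avoiding walks)] -/
theorem twoPoint_layered_le_pow_at_three_fifths (hβ : 0 < β) (hp : 0 < Jp) (hK : β * Jp = 3 / 5) (hz0 : 0 ≤ Jz)
    (hz : Jz ≤ 19 / 100 * Jp) (Λ : Finset (Site 3)) (a c : Λ) :
    twoPoint (layeredXYCoupling β Jp Jz Λ) a c ≤ (965 / 1000 : ℝ) ^ (layer a - layer c).natAbs := by
  have ht : Real.tanh (β * Jp / 2) ≤ 2914 / 10000 := by
    rw [hK, show ((3 : ℝ) / 5) / 2 = 3 / 10 by norm_num]; exact tanh_three_tenths_le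
  refine twoPoint_layered_le_pow_of_sawSeries_le hβ hp hz0 Λ ht (by norm_num) ?_ a c
  have hβJz : β * Jz ≤ 57 / 500 := by
    have := mul_le_mul_of_nonneg_left hz hβ.le
    calc β * Jz ≤ β * (19 / 100 * Jp) := this
      _ = 19 / 100 * (β * Jp) := by ring
      _ = 57 / 500 := by rw [hK]; norm_num
  have hF : (0 : ℝ) ≤ (1 + 4 * (2914 / 10000 : ℝ) + 12 * (2914 / 10000) ^ 2 + 36 * (2914 / 10000) ^ 3 +
      100 * (2914 / 10000) ^ 4 + 284 * (2914 / 10000) ^ 5 + 780 * (2914 / 10000) ^ 6 + 2172 * (2914 / 10000) ^ 7 +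
      5916 * (2914 / 10000) ^ 8 + 16268 * (2914 / 10000) ^ 9) / (1 - 44100 * (2914 / 10000) ^ 10) := by norm_num
  calc β * Jz * _ ≤ 57 / 500 * _ := mul_le_mul_of_nonneg_right hβJz hF
    _ ≤ 965 / 1000 := by norm_num

/-- **Row `k_BT = (π/2)J∥` — the Nelson–Kosterlitz temperature of the single layer at its BARE stiffness**
(`βJ∥ = 2/π`, planar Ising at `β' = 1/π`, `tanh(1/π) ≤ 0.308`, `F(0.308) ≤ 12.449`, `βJ⊥ ≤ 1/(4π) ≤ 0.07958`): for every
`J⊥ ≤ J∥/8` the interlayer two-point function of the classical layered XY model decays like `(0.9907)^{|Δℓ|}` on every finite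
`Λ ⊂ ℤ³`, uniformly in the volume — **the layered comparison model is NOT ordered across the layers at
`T = (π/2)·J∥` for any anisotropy `J⊥/J∥ ≤ 1/8`** (kernel, hypothesis-free, no certificate), whereas for
`J⊥ ≥ 0.9·J∥` it IS ordered there (tree `AnisotropicRotator.layered_plateau_ge_at_pi_div_two`). Cell reading
(`pub/hubbard-tc`, ASSUMPTIONS K4 / K4-a): the no-factor 2D→3D form «`T_c^{3D} ≤ (π/2)·J∥`» holds for the comparison
model at every `Δ ≤ 1/8` and fails at `Δ ≥ 9/10`; the float threshold is `Δ* = 0.27 ± 0.02` [Monte Carlo, not used].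
[cite: Lieb1980, eq. (23) and notes added in proof (2)] [cite: AizenmanSimon1980RotorIsing, eq. (1)]
[cite: Fisher1967, Phys. Rev. 162 (1967) 480 (T_c bounds from self-avoiding walks)] -/
theorem twoPoint_layered_le_pow_at_pi_div_two (hβ : 0 < β) (hp : 0 < Jp) (hK : β * Jp = 2 / Real.pi)
    (hz0 : 0 ≤ Jz) (hz : Jz ≤ Jp / 8) (Λ : Finset (Site 3)) (a c : Λ) :
    twoPoint (layeredXYCoupling β Jp Jz Λ) a c ≤ (9907 / 10000 : ℝ) ^ (layer a - layer c).natAbs := by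
  have ht : Real.tanh (β * Jp / 2) ≤ 308 / 1000 := by
    rw [hK, show ((2 : ℝ) / Real.pi) / 2 = 1 / Real.pi by ring]; exact tanh_inv_pi_le
  refine twoPoint_layered_le_pow_of_sawSeries_le hβ hp hz0 Λ ht (by norm_num) ?_ a c
  have hβJz : β * Jz ≤ 7958 / 100000 := by
    have h1 := mul_le_mul_of_nonneg_left hz hβ.le
    have h2 : β * (Jp / 8) = (2 / Real.pi) / 8 := by rw [← hK]; ring
    have h3 : (2 / Real.pi : ℝ) / 8 ≤ 7958 / 100000 := by
      rw [div_div, div_le_iff₀ (by positivity)]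
      have := Real.pi_gt_d6
      nlinarith
    linarith [h1, h2.le, h3]
  have hF : (0 : ℝ) ≤ (1 + 4 * (308 / 1000 : ℝ) + 12 * (308 / 1000) ^ 2 + 36 * (308 / 1000) ^ 3 +
      100 * (308 / 1000) ^ 4 + 284 * (308 / 1000) ^ 5 + 780 * (308 / 1000) ^ 6 + 2172 * (308 / 1000) ^ 7 +
      5916 * (308 / 1000) ^ 8 + 16268 * (308 / 1000) ^ 9) / (1 - 44100 * (308 / 1000) ^ 10) := by norm_num
  calc β * Jz * _ ≤ 7958 / 100000 * _ := mul_le_mul_of_nonneg_right hβJz hF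
    _ ≤ 9907 / 10000 := by norm_num

/-- **Row `k_BT = J∥/log 2 = 1.4427·J∥`** (`βJ∥ = log 2`, planar Ising at `tanh β' = 1/3` exactly, `F(1/3) ≤ 44.22`):
for every `J⊥ ≤ J∥/32` the interlayer two-point function decays like `(0.96)^{|Δℓ|}` on every finite `Λ ⊂ ℤ³` — the
lowest temperature of this file's table (the census method reaches `T > 1.398·J∥`).
[cite: Lieb1980, eq. (23) and notes added in proof (2)]
[cite: Fisher1967, Phys. Rev. 162 (1967) 480 (T_c bounds from self-avoiding walks)] -/
theorem twoPoint_layered_le_pow_at_log_two (hβ : 0 < β) (hp : 0 < Jp) (hK : β * Jp = Real.log 2)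
    (hz0 : 0 ≤ Jz) (hz : Jz ≤ Jp / 32) (Λ : Finset (Site 3)) (a c : Λ) :
    twoPoint (layeredXYCoupling β Jp Jz Λ) a c ≤ (96 / 100 : ℝ) ^ (layer a - layer c).natAbs := by
  have ht : Real.tanh (β * Jp / 2) ≤ 1 / 3 := by rw [hK]; exact tanh_half_log_two_le
  refine twoPoint_layered_le_pow_of_sawSeries_le hβ hp hz0 Λ ht (by norm_num) ?_ a c
  have hβJz : β * Jz ≤ 0.6931471808 / 32 := by
    have h1 := mul_le_mul_of_nonneg_left hz hβ.le
    have h2 : β * (Jp / 32) = Real.log 2 / 32 := by rw [← hK]; ring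
    have h3 : Real.log 2 / 32 ≤ 0.6931471808 / 32 :=
      div_le_div_of_nonneg_right Real.log_two_lt_d9.le (by norm_num)
    linarith [h1, h2.le, h3]
  have hF : (0 : ℝ) ≤ (1 + 4 * (1 / 3 : ℝ) + 12 * (1 / 3) ^ 2 + 36 * (1 / 3) ^ 3 +
      100 * (1 / 3) ^ 4 + 284 * (1 / 3) ^ 5 + 780 * (1 / 3) ^ 6 + 2172 * (1 / 3) ^ 7 +
      5916 * (1 / 3) ^ 8 + 16268 * (1 / 3) ^ 9) / (1 - 44100 * (1 / 3) ^ 10) := by norm_num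
  calc β * Jz * _ ≤ 0.6931471808 / 32 * _ := mul_le_mul_of_nonneg_right hβJz hF
    _ ≤ 96 / 100 := by norm_num

end Decimals

end PlaneRotator

end Literature.Probability.LatticeModels

end
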